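import Mathlib
import Summits.Langlands.Langlands.Theses.PhantomRMYoshida
import Literature.NumberTheory.GaloisRepresentations.ModPGaloisRep
import Literature.NumberTheory.GaloisRepresentations.SerreWeight

/-!
# Line `burkhardt-weddle-two-three-anchor` — skeleton for crux `PhantomRMYoshida.StableYoshidaCongruence`
# (stmt-Langlands-13640, route-Langlands-PhantomRMYoshida; crux-plan, round 1)

**Idea** (crux-idea card `burkhardt-weddle-two-three-anchor`, ideator 3; triage r1: pass ×3, merge ≈
`level-three-weierstrass-switch`).  At `p = 3` the "+1" that the singular weight `(2,2)` lacks
(expected dimension `-1`, Disproof §6) is supplied by a RATIONAL MODULI SPACE: for every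
`ρ̄ : Γ_ℚ → GSp₄(𝔽₃)` with similitude `ε̄⁻¹` the twisted Burkhardt / Weddle moduli space `P(ρ̄)` of
principally polarised abelian surfaces with `A[3] ≅ ρ̄^∨` (and an odd theta characteristic) is smooth
and RATIONAL over `ℚ` (BoxerEtAl2021 §10.2, Bruin–Filatov arXiv:2207.04393 Thm 1.2), with NO
irreducibility or big-image hypothesis on `ρ̄` (BoxerCalegariGeePilloni2025 Rem. 9.4.4 = Remark 418).
Ekedahl/weak approximation on `P(ρ̄)` with local conditions at `2, 3, ∞` (their Lemma 9.4.1–9.4.2 =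
Lemmas 415–416, the "2–3 switch") produces a genus-2 Jacobian `B/ℚ` with `ρ̄_{B,3} ≅ ρ̄`, good ordinary
(and 3-distinguished, Remark 417) reduction at `3`, mod-2 image `S₅(b)` and `End(B_ℚ̄) = ℤ`; the 2-ADIC
modularity theorem (their Thm 8.3.x = Theorem 386: `A₅(b) ⊆ im ρ̄_{B,2} ⊆ S₅(b)`, ordinary
2-distinguished at 2 — nothing is asked at 3) makes `B` modular, and `ρ₀ := ρ_{B,3} = H¹_ét(B_ℚ̄, ℚ̄₃)`
is an IRREDUCIBLE (Faltings + `End = ℤ`), symplectic-`ε⁻¹`, Greenberg-ordinary `(0,0,1,1)`,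
3-distinguished lift with residual pair `(σ̄, σ̄')`, automorphic on `GL₄` (Arthur / Gee–Taïbi transfer
of the weight-2 general-type `π_B`).  The lever never looks at the crux's `Sh`-witness beyond the
residual local shape at `3`, so it covers the REDUCIBLE-witness surplus of the item (no `Irr'`-trap,
Disproof §3.2) — on its sector.

**Sector** (triage sharpenings r1-1/2/3, carried as explicit hypotheses): `p = 3`;
`σ̄ ⊕ σ̄'` is `𝔽₃`-RATIONAL (all characteristic polynomials of `σ̄(g) ⊕ σ̄'(g)` lie in `𝔽₃[X]`: both
constituents `GL₂(𝔽₃)`-rational, or the phantom-RM pair `σ̄' = σ̄^(3)` over `𝔽₉`); `σ̄|Γ_{ℚ₃}`,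
`σ̄'|Γ_{ℚ₃}` PEU RAMIFIÉES (⇔ `ρ̄^∨|G_{ℚ₃}` finite flat; H5 alone allows très ramifié / Steinberg-at-3
witnesses, outside Lemma 416 as printed); `σ̄`, `σ̄'` UNRAMIFIED AT 2 with
`charpoly ρ̄(Frob₂) ≠ (x² ± x + 2)²` (classes `4C/12C` of `PGSp₄(𝔽₃) ∖ PSp₄(𝔽₃)`, Thm 9.2.x = 397).
Off the sector (all `p ≥ 5`: `A₂(ρ̄)` of general type, Hulek–Sankaran, Disproof §5 R4; and the
`p = 3` pairs failing a side condition) the line says NOTHING: that residue is `stub_offSector`, the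
honest open remainder of the crux (triage r1-2: "it cannot close the item as filed, but it closes the
route's motivating case"; r1-3: "use as the p = 3 stub of a line").

**Shape.** `StableYoshidaCongruence_of : StableYoshidaCongruence` (no hypotheses) is proved at the
end of this file from four `stub_*` theorems by a case split on the sector; `sorry` occurs only inside
the stubs; stub statements mention only Mathlib, `Literature.*` and (verbatim, as `let`s) the clauses
of the route decl, so each can land as `Theorems/StableYoshidaCongruence<Stub>.lean` with
`--supports stmt-Langlands-13640`.

* `stub_symplecticModelFp` (M; provable now) — DESCENT: an `𝔽_p`-rational pair descends, with its
  orthogonal-sum symplectic form of multiplier `ε̄⁻¹`, to `ρ̄_p : Γ_ℚ → GSp₄(𝔽_p)` (Schur indices are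
  `1` over finite fields; a non-degenerate `𝔽_p`-point of the 2-dimensional space of invariant
  alternating forms exists by counting).  Turns the crux's data `(σ̄, σ̄')` over `k` into BCGP's input.
* `stub_ordinaryLinesAtP` (M/L; provable now) — RESIDUAL ORDINARY LINES: the `Sh`-witness `ρ`
  (Greenberg-ordinary `(0,0,1,1)`, residually distinguished, residual pair `(σ̄, σ̄')`) forces BOTH
  `σ̄|Γ_{ℚ_p}` and `σ̄'|Γ_{ℚ_p}` to contain an unramified stable line, with DISTINCT unramified
  characters (stable-lattice / reduction argument; this is Disproof §4's "H5 certifies the ordinary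
  `p`-distinguished Yoshida pair", made a lemma).  The only use the line makes of H5.
* `stub_burkhardtWeddleSwitch` (XL, in print modulo the tree's dictionary; HARDEST) — the 2–3 SWITCH:
  BoxerCalegariGeePilloni2025 Lemma 9.4.2 + Thm 8.3.x (+ Thm 9.5.2's last paragraph: transfer to a
  cuspidal `Π` on `GL₄/ℚ`), Faltings, and the translation of "good ordinary 3-distinguished
  reduction / `ρ̄_{B,3} ≅ ρ̄` / `End = ℤ` / modular" into `Sh` / residual pair / irreducible / `AutGL4`.
* `stub_offSector` (open; the honest residue) — the crux's implication for data OUTSIDE the sector.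
  Not claimed by this line; it is where `serre-dual-ribet-square` (coherent Ribet square at a
  cross-ratio prime) or the purity reduction must plug in, or where the planner restates the item
  (`Irr'`, Disproof `closes_irr'`, or the `p = 3` sector) as all three triagers recommend.

**Glue** (sorry-free, below): `Classical.em (sector)`; on the sector: Stub 2 (ordinary lines from the
H5-witness) + Stub 1 (descent) feed Stub 3, whose conclusion IS the crux's conclusion at these data;
off the sector: Stub 4.  `AutGL2 σ̄`, `AutGL2 σ̄'` (H1) are consumed only by Stub 4 — the motivic
sector needs no residual modularity (BCGP's 2-adic theorem does not look at `ρ̄_{B,3}` at all).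

**Disproof used** (cdisprove cycle 3, `Cruxes/StableYoshidaCongruence/Disproof.lean`, in-tree, read in
full): §2 `exists_cuspForm_of_not_crux` — no `_false_without_H` theorem exists for any `H` (automorphic
wall), so there is no obstruction of that form to honour; instead the stub set honours §4's
load-bearing analysis: H5 (`∃ ρ, Sh ρ`) is used exactly once, in `stub_ordinaryLinesAtP`, and only for
what §4 says it certifies (ordinary-shaped, `p`-distinguished pair); H1 is decoration (§3.5
`cruxNoAutAt_iff_of_KW`) and is not used on the sector; H3b/H4 are passed to Stub 1 only.  §3.2
`irr'At_of_sectorAt` / `sector_iff_irr'` (the `Irr'`-trap): avoided — no stub takes an irreducible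
witness; Stub 3 manufactures `ρ₀` from `ρ̄` alone.  §3.3 `crux_iff_lifting`: on the sector the line
proves `IrrLiftAt` AND automorphy outright (no appeal to the target).  §5 R2 is exactly this sector
(the cdisprover's own reading of Bruin–Filatov Thm 1.2(4)); §5 R1 at `p = 3` (triage r1-3 note: twist
pairs `σ̄' ≅ σ̄ ⊗ ε̄χ_d` ARE eligible at `p = 3`) lies inside the sector when `𝔽₃`-rational and is
otherwise in `stub_offSector`; §6 (expected dimension `-1`, accidents only) is why `stub_offSector` is
left whole.  No `Negative/` lemma has landed for this crux (nothing to import); negatives index: 1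
entry (K3 Kuga–Satake anchor), unrelated; no stub is an instance of a refuted statement.
-/

open Literature.NumberTheory.GaloisRepresentations Literature.NumberTheory.Automorphic
open IsDedekindDomain Polynomial

namespace Summit.Langlands.Langlands.Cruxes.StableYoshidaCongruence.BurkhardtWeddleTwoThreeAnchor

set_option linter.dupNamespace false

/-! ## Stub 1 — descent of an `𝔽_p`-rational Yoshida pair to a symplectic `𝔽_p`-model -/

/-- **Stub 1 (symplectic `𝔽_p`-model; DESCENT).**  `p` odd, `k` algebraically closed of
characteristic `p` (discrete), `σ, σ' : Γ_ℚ → GL₂(k)` irreducible, non-conjugate, with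
`det σ = det σ' = ε̄⁻¹`, and `𝔽_p`-RATIONAL: for every `g ∈ Γ_ℚ` the polynomial
`charpoly σ(g) · charpoly σ'(g) ∈ k[X]` comes from `𝔽_p[X]`.  Then there are a continuous
`ρ̄_p : Γ_ℚ → GL₄(𝔽_p)` and `h ∈ GL₄(k)` with `ρ̄_p ⊗ k = h (σ ⊕ σ') h⁻¹` (block-diagonal sum,
`Fin 2 ⊕ Fin 2 ≃ Fin 4` by `finSumFinEquiv`) and `ρ̄_p` symplectic for some alternating `J₀ ∈ M₄(𝔽_p)`,
`det J₀ ≠ 0`, with multiplier `ε̄⁻¹`: `ρ̄_p(g)ᵀ J₀ ρ̄_p(g) = ε̄(g)⁻¹ J₀`.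
Why true: the images are finite (`k` discrete); `V = σ ⊕ σ'` is semisimple with `𝔽_p`-rational
characteristic polynomials, so `V ≅ V^{(p)}` (Brauer–Nesbitt), the constituents form Frobenius orbits,
and each absolutely irreducible constituent is realisable over the field of its character because
finite division rings are commutative (Schur index `1`; Isaacs Thm 9.14 / Curtis–Reiner §74), whence an
`𝔽_p`-form `V₀`.  `Γ`-invariant alternating forms on `V` with multiplier `ε̄⁻¹` are
`Hom_Γ(Λ²V, ε̄⁻¹) = Hom(det σ, ε̄⁻¹) ⊕ Hom(det σ', ε̄⁻¹) ⊕ Hom_Γ(σ ⊗ σ', ε̄⁻¹)`, of dimension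
`1 + 1 + 0` (the cross term is `Hom_Γ(σ, σ'^∨ ⊗ ε̄⁻¹) = Hom_Γ(σ, σ') = 0` by non-conjugacy), the
degenerate ones are the union of two lines, and this linear system is defined over `𝔽_p`, so its
`𝔽_p`-points (`p²` of them) are not covered by two lines (`≤ 2p - 1` points): a non-degenerate
`𝔽_p`-rational `J₀` exists; `J₀ᵀ = -J₀` is alternating since `p ≠ 2`.  Covers both sector shapes
(both constituents `GL₂(𝔽_p)`-rational, or `σ' = σ^{(p)}` over `𝔽_{p²}` — the phantom-RM pair, where
`V₀ = Res_{𝔽_{p²}/𝔽_p} σ`).  Size M (finite-group representation theory over finite fields; Mathlib has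
`littleWedderburn`; Brauer–Nesbitt through the tree's `HasResidualPair`/charpoly API).
[cite: Isaacs1976, Thm 9.14 and Cor. 9.22; CurtisReiner1962, §74; BoxerEtAl2021, §2.1.1 (GSp₄, similitude)] -/
theorem stub_symplecticModelFp :
    ∀ (p : ℕ) [Fact p.Prime], p ≠ 2 → ∀ (k : Type) [Field k] [CharP k p] [IsAlgClosed k]
      [TopologicalSpace k] [DiscreteTopology k]
      (σ σ' : FramedGaloisRep ℚ k 2),
      let εb : Field.absoluteGaloisGroup ℚ →* (ZMod p)ˣ :=
        (modularCyclotomicCharacter (AlgebraicClosure ℚ)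
          (HasEnoughRootsOfUnity.natCard_rootsOfUnity (AlgebraicClosure ℚ) p)).comp
          (MulSemiringAction.toRingAut (Field.absoluteGaloisGroup ℚ) (AlgebraicClosure ℚ))
      σ.toGaloisRep.IsIrreducible → σ'.toGaloisRep.IsIrreducible →
      (∀ g, FramedRep.det σ g = (Units.map (ZMod.castHom (dvd_refl p) k).toMonoidHom (εb g))⁻¹ ∧
        FramedRep.det σ' g = FramedRep.det σ g) →
      (¬ ∃ g : GL (Fin 2) k, ∀ x, g * σ x * g⁻¹ = σ' x) →
      (∀ g : Field.absoluteGaloisGroup ℚ, ∃ Q : Polynomial (ZMod p),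
        Q.map (ZMod.castHom (dvd_refl p) k) = (σ g).val.charpoly * (σ' g).val.charpoly) →
      ∃ (ρb : FramedGaloisRep ℚ (ZMod p) 4) (h : GL (Fin 4) k),
        (∀ g, (Matrix.GeneralLinearGroup.map (ZMod.castHom (dvd_refl p) k) (ρb g)).val =
          h.val * Matrix.reindex finSumFinEquiv finSumFinEquiv
            (Matrix.fromBlocks (σ g).val 0 0 (σ' g).val) * (h⁻¹).val) ∧
        ρb.IsSymplecticWithMultiplierFun (fun g => (((εb g)⁻¹ : (ZMod p)ˣ) : ZMod p)) := by
  sorry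

/-! ## Stub 2 — the `Sh`-witness forces distinct unramified lines in `σ̄|Γ_{ℚ_p}`, `σ̄'|Γ_{ℚ_p}` -/

/-- **Stub 2 (residual ordinary lines at `p`; the only use of hypothesis H5).**  `p` odd; `σ, σ'`
irreducible with `det σ = det σ' = ε̄⁻¹`; `ρ : Γ_ℚ → GL₄(ℚ̄_p)` Greenberg-ordinary of shape
`(0,0,1,1)` and residually distinguished at the place `v ∣ p`, with residual pair `(σ, σ')` through
`red` (the three clauses of the crux's `Sh`, the symplectic one unused).  Then at every `v ∣ p` there
are frames `g, g' ∈ GL₂(k)` in which `σ|Γ_{ℚ_v}`, `σ'|Γ_{ℚ_v}` (`toLocal v`) are upper triangular with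
UNRAMIFIED first diagonal character (`= 1` on the inertia group `absInertia ℚ_v`), and these two
unramified characters `μ, μ'` are DISTINCT (differ at some `τ ∈ Γ_{ℚ_v}`).
Why true: `ρ(Γ_ℚ)` is compact, hence inside `GL₄(E)`, `E/ℚ_p` finite (Baire), with a stable
`𝒪_E`-lattice `Λ` (or directly a `ℤ̄_p`-frame, tree `StableLatticeValuationRing`); the Greenberg frame
gives the unramified plane `U = V^{I_v}` (exactly the inertia invariants, as `ε⁻¹` has infinite order
on `I_v`, `p` odd — so `U` is canonical and defined over `E`), `Λ ∩ U` is saturated of rank `2`, and its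
reduction `W ⊂ Λ̄ ⊗ k` is a `Γ_v`-stable inertia-trivial plane with Jordan–Hölder characters
`{ū₁, ū₂}`, residually DISTINCT by `IsResiduallyDistinguishedAt` (the diagonal characters of any
triangular frame of `ρ|Γ_v` are the same multiset, and the weight-`0` ones are the unramified ones).
`Λ̄ ⊗ k` has semisimplification `σ ⊕ σ'` (residual-pair clause + Chebotarev + Brauer–Nesbitt, tree
`hasResidualPair_iff_forall`), so it is an extension `0 → σ₁ → Λ̄ ⊗ k → σ₂ → 0`, `{σ₁, σ₂} = {σ, σ'}`;
`W ∩ σ₁` is neither `W` nor `0` (else `σ₁|Γ_v` or `σ₂|Γ_v` would be unramified, but `det = ε̄⁻¹` is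
ramified at `p ≠ 2`), so it is an unramified stable LINE of `σ₁|Γ_v` with character `μ₁ ∈ {ū₁, ū₂}` and
the image of `W` in `σ₂` is an unramified stable line with the other character `μ₂ ≠ μ₁`.  (This is
Disproof §4's paper claim "H5 ⟺ (σ̄, σ̄') is an ordinary `p`-distinguished Yoshida pair", forward
direction, as a lemma.)  Size M/L (lattice + reduction bookkeeping over `𝒪_{ℚ̄_p}` or `𝒪_E`).
[cite: BoxerEtAl2021, §7.3 Def. (p-distinguished weight 2 ordinary); SerreAbelianLadic1968, I §1.1, §2.3;
DeligneSerre1974, §6 (réduction mod λ); Greenberg1991, §2] -/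
theorem stub_ordinaryLinesAtP :
    ∀ (p : ℕ) [Fact p.Prime], p ≠ 2 → ∀ (k : Type) [Field k] [CharP k p] [IsAlgClosed k]
      [TopologicalSpace k] [DiscreteTopology k] (red : Valued.integer (PadicAlgCl p) →+* k)
      (σ σ' : FramedGaloisRep ℚ k 2) (ρ : FramedGaloisRep ℚ (PadicAlgCl p) 4),
      let εb : Field.absoluteGaloisGroup ℚ →* (ZMod p)ˣ :=
        (modularCyclotomicCharacter (AlgebraicClosure ℚ)
          (HasEnoughRootsOfUnity.natCard_rootsOfUnity (AlgebraicClosure ℚ) p)).comp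
          (MulSemiringAction.toRingAut (Field.absoluteGaloisGroup ℚ) (AlgebraicClosure ℚ))
      let OrdLine := fun (v : HeightOneSpectrum (NumberField.RingOfIntegers ℚ))
          (s : FramedGaloisRep ℚ k 2) (g : GL (Fin 2) k) =>
        (∀ τ, ((g * s.toLocal v τ * g⁻¹ : GL (Fin 2) k) : Matrix (Fin 2) (Fin 2) k) 1 0 = 0) ∧
        (∀ τ ∈ absInertia (v.adicCompletion ℚ),
          ((g * s.toLocal v τ * g⁻¹ : GL (Fin 2) k) : Matrix (Fin 2) (Fin 2) k) 0 0 = 1)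
      σ.toGaloisRep.IsIrreducible → σ'.toGaloisRep.IsIrreducible →
      (∀ g, FramedRep.det σ g = (Units.map (ZMod.castHom (dvd_refl p) k).toMonoidHom (εb g))⁻¹ ∧
        FramedRep.det σ' g = FramedRep.det σ g) →
      (∀ v : HeightOneSpectrum (NumberField.RingOfIntegers ℚ),
        ((p : ℕ) : NumberField.RingOfIntegers ℚ) ∈ v.asIdeal →
          ρ.IsGreenbergOrdinaryOfShapeAt v ![0, 0, 1, 1] ∧ ρ.IsResiduallyDistinguishedAt v ![0, 0, 1, 1]) →
      (∀ᶠ v : HeightOneSpectrum (NumberField.RingOfIntegers ℚ) in Filter.cofinite,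
        ρ.IsUnramifiedAt v ∧ σ.IsUnramifiedAt v ∧ σ'.IsUnramifiedAt v ∧
        ∃ (P : Polynomial (Valued.integer (PadicAlgCl p))) (P₁ P₂ : Polynomial k),
          ρ.HasFrobCharpolyAt v (P.map (Valued.integer (PadicAlgCl p)).subtype) ∧
          σ.HasFrobCharpolyAt v P₁ ∧ σ'.HasFrobCharpolyAt v P₂ ∧ P.map red = P₁ * P₂) →
      ∀ v : HeightOneSpectrum (NumberField.RingOfIntegers ℚ),
        ((p : ℕ) : NumberField.RingOfIntegers ℚ) ∈ v.asIdeal →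
          ∃ g g' : GL (Fin 2) k, OrdLine v σ g ∧ OrdLine v σ' g' ∧
            ∃ τ, ((g * σ.toLocal v τ * g⁻¹ : GL (Fin 2) k) : Matrix (Fin 2) (Fin 2) k) 0 0 ≠
              ((g' * σ'.toLocal v τ * g'⁻¹ : GL (Fin 2) k) : Matrix (Fin 2) (Fin 2) k) 0 0 := by
  sorry

/-! ## Stub 3 — the lever: Burkhardt–Weddle rationality + BCGP2025's 2–3 switch and 2-adic modularity -/

/-- **Stub 3 (Burkhardt–Weddle 2–3 switch; HARDEST — in print modulo the tree's dictionary).**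
`p = 3`.  INPUT: `ρ̄₃ : Γ_ℚ → GL₄(𝔽₃)` symplectic with multiplier `ε̄⁻¹` whose base change to `k` is
`h (σ ⊕ σ') h⁻¹` (Stub 1); at the place `v ∣ 3`, `σ|Γ_{ℚ₃}` and `σ'|Γ_{ℚ₃}` have unramified stable lines
with DISTINCT unramified characters (Stub 2) and are PEU RAMIFIÉES (tree `ModPGaloisRep.IsPeuRamifie`:
the upper ramification groups `I^u`, `u > 1`, act trivially — for these ordinary shapes exactly
"`ρ̄₃^∨|G_{ℚ₃}` is (dual to) finite flat", Serre 1987 §2.4/§2.8, Edixhoven 1992 §2, Raynaud `e = 1`);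
at the place `v ∣ 2`, `σ, σ'` are unramified and the product of their Frobenius polynomials is not
`(X² ± X + 2)²` (⇔ `ρ̄₃(Frob₂) ∉ 4C ∪ 12C` in `PGSp₄(𝔽₃) ∖ PSp₄(𝔽₃)`; the excluded pair is stable under
`x ↦ 2/x`, so the arithmetic/geometric Frobenius convention is immaterial).  OUTPUT: for every
`hcpt`, `ι : ℚ̄₃ ≃ ℂ` an IRREDUCIBLE `ρ₀ : Γ_ℚ → GL₄(ℚ̄₃)` of shape `Sh` (symplectic-`ε⁻¹`,
Greenberg-ordinary `(0,0,1,1)` and residually distinguished at `3`, residual pair `(σ, σ')` through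
`red`) which is automorphic (`AutGL4`: an L-algebraic cuspidal `Π` on `GL₄(𝔸_ℚ)` with Satake–Frobenius
matching a.e., `arithFrobPolyOfSatake ι q_v 1`).  Deliberately NO irreducibility / non-conjugacy /
determinant hypothesis on `σ, σ'` (BCGP's switching lemma has none, Remark 418; the multiplier is
carried by the model) and no `Sh`-witness: the stub is strictly about the `𝔽₃`-model.
Why true (paper proof, every arrow in print): (i) `ρ̄₃|G_{ℚ₃}` has the unramified plane
`μ ⊕ μ'` (inertia invariants, descends to `𝔽₃`), Lagrangian because an invariant alternating form on
an unramified plane with ramified multiplier `ε̄⁻¹ = ε̄` vanishes, so `ρ̄₃` is ordinary with similitude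
`ε̄⁻¹` in the sense of BCGP2025 Lemma 9.3.x (= Lemma 413, which allows `𝔽₉`-eigenvalues: `q̄(x)` may
be `x² + 1`, `x² ± x - 1`) and 3-distinguished (`μ ≠ μ'`); peu ramifié ⇒ `ρ̄₃^∨|G_{ℚ₃}` finite flat.
(ii) BoxerCalegariGeePilloni2025 Lemma 9.4.2 (= Lemma 416 "switching"; hypotheses: similitude `ε̄⁻¹`,
`ρ̄^∨|G_{ℚ₃}` ordinary and finite flat, `ρ̄|G_{ℚ₂}` unramified with `Frob₂ ∉ 4C/12C` — NO irreducibility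
or image hypothesis, cf. Remark 418; proof = Lemma 9.4.1 weak approximation avoiding a thin set on the
RATIONAL variety `𝓜₂ʷ(ρ̄) ⊂ P(ρ̄) ≃_bir ℙ³`, BoxerEtAl2021 §10.2 / Bruin–Filatov 2022 Thm 1.2) gives a
genus-2 curve `X/ℚ`, `B = Jac X`, with `ρ̄_{B,3} ≅ ρ̄₃`, `B` good ordinary at `3` (3-distinguished is
residual here, cf. Remark 417), good-or-semistable ordinary and 2-distinguished at `2`,
`im ρ̄_{B,2} = S₅(b)` with complex conjugation of class `(**)(**)`, `End(B_ℚ̄) = ℤ`.  (iii) Theorem 8.3.x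
(= Theorem 386; 2-adic: `A₅(b) ⊆ im ρ̄_{B,2} ⊆ S₅(b)`, `c` of order `2` in `A₅(b)`, ordinary
2-distinguished at `2`) ⇒ `B` is modular: a weight-2 cuspidal `π` on `GSp₄/ℚ`, `ρ_{π,ℓ} ≅ ρ_{B,ℓ}` for
all `ℓ`, necessarily of general type; Arthur 2013 / Gee–Taïbi 2019 transfer it to a cuspidal `Π` on
`GL₄/ℚ` with `L(s, H¹(B)) = L(s, Π)` (stated verbatim as the conclusion of their Theorem 9.5.2 = 420);
in the summit's L-normalisation the Satake parameters of `Π ⊗ |det|^{1/2}`-type twist invert to the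
arithmetic-Frobenius eigenvalues (`arithFrobPolyOfSatake … 1`, Buzzard–Gee) — the same dictionary debt
as `SerreKWAutomorphicGL2`.  (iv) `ρ₀ := ρ_{B,3} = H¹_ét(B_ℚ̄, ℚ₃) ⊗ ℚ̄₃` framed: Weil pairing ⇒
symplectic with multiplier `ε⁻¹` (cohomological convention, BCGP2025 §2: `ν ∘ ρ_{A,p} = ε⁻¹` = the
crux's); good ordinary 3-distinguished reduction ⇒ `ρ₀|G_{ℚ₃} ≃ (λ_α, λ_β ; ε⁻¹λ_β⁻¹, ε⁻¹λ_α⁻¹)`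
crystalline with `ᾱ ≠ β̄`, i.e. `IsGreenbergOrdinaryOfShapeAt v (0,0,1,1)` (inertia trivial on the
unramified plane, scalar `ε⁻¹` on the quotient) and `IsResiduallyDistinguishedAt`; `ρ̄_{B,3} ≅ ρ̄₃` and
`ρ̄₃ ⊗ k ∼ σ ⊕ σ'` ⇒ for `v ∤ 6N_B` the integral Frobenius polynomial (`∈ ℤ[X]`) reduces through `red`
to `charpoly σ(Frob_v) · charpoly σ'(Frob_v)`; `End(B_ℚ̄) = ℤ` + Faltings (semisimplicity, Tate
conjecture) ⇒ `End_{Γ_ℚ}(V₃ B) = ℚ₃` ⇒ `ρ₀` absolutely irreducible.  Why it might fail: only in the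
dictionary — (a) "peu ramifié (upper numbering) ⇒ finite flat" for the split ordinary shape at
`p = 3` when `μ² = 1` (`H¹(G_{ℚ₃}, ε̄)`: Kummer classes of units — standard); (b) the half-twist /
normalisation of `AutGL4` (shared with the whole route); (c) the `4C/12C ⇔ (x² ± x + 2)²` translation
(BCGP2025 Thm 9.5.2 states it).  Size XL (named facts to vendor: BCGP2025 L9.4.2 + T8.3.x + transfer as
ONE cited Prop over abelian-surface vocabulary `Literature.AlgebraicGeometry.Motives.AbelianVariety`,
`tateGaloisRep`, `HasGoodReductionAt`; Faltings is in the tree's `FaltingsAbelian*`).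
[cite: BoxerCalegariGeePilloni2025, Lemma 9.4.2 (switching), Remarks 9.4.3–9.4.4, Theorem 8.3.x (386),
Theorem 9.5.2 (420), Theorem 9.2.x (397: 4C/12C); BoxerEtAl2021, §7.3 Def. 263, §10.2 (P(ρ̄) rational);
arXiv:2207.04393, Thm 1.2(4); Faltings1983; Arthur2013; GeeTaibi2019; Serre1987, §2.4, §2.8;
Edixhoven1992, §2; BuzzardGeeLMS2014, Conj. 3.2.1] -/
theorem stub_burkhardtWeddleSwitch :
    ∀ (p : ℕ) [Fact p.Prime], p ≠ 2 → p = 3 → ∀ (k : Type) [Field k] [CharP k p] [IsAlgClosed k]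
      [TopologicalSpace k] [DiscreteTopology k] (red : Valued.integer (PadicAlgCl p) →+* k)
      (σ σ' : FramedGaloisRep ℚ k 2) (ρb : FramedGaloisRep ℚ (ZMod p) 4) (h : GL (Fin 4) k),
      let εb : Field.absoluteGaloisGroup ℚ →* (ZMod p)ˣ :=
        (modularCyclotomicCharacter (AlgebraicClosure ℚ)
          (HasEnoughRootsOfUnity.natCard_rootsOfUnity (AlgebraicClosure ℚ) p)).comp
          (MulSemiringAction.toRingAut (Field.absoluteGaloisGroup ℚ) (AlgebraicClosure ℚ))
      let Sh := fun r : FramedGaloisRep ℚ (PadicAlgCl p) 4 =>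
        (r.IsSymplecticWithMultiplierFun (fun g => algebraMap ℚ_[p] (PadicAlgCl p)
          ((((GaloisRep.cyclotomicCharacter ℚ p g)⁻¹ : ℤ_[p]ˣ) : ℤ_[p]) : ℚ_[p])) ∧
        (∀ v : HeightOneSpectrum (NumberField.RingOfIntegers ℚ),
          ((p : ℕ) : NumberField.RingOfIntegers ℚ) ∈ v.asIdeal →
            r.IsGreenbergOrdinaryOfShapeAt v ![0, 0, 1, 1] ∧ r.IsResiduallyDistinguishedAt v ![0, 0, 1, 1]) ∧
        (∀ᶠ v : HeightOneSpectrum (NumberField.RingOfIntegers ℚ) in Filter.cofinite,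
          r.IsUnramifiedAt v ∧ σ.IsUnramifiedAt v ∧ σ'.IsUnramifiedAt v ∧
          ∃ (P : Polynomial (Valued.integer (PadicAlgCl p))) (P₁ P₂ : Polynomial k),
            r.HasFrobCharpolyAt v (P.map (Valued.integer (PadicAlgCl p)).subtype) ∧
            σ.HasFrobCharpolyAt v P₁ ∧ σ'.HasFrobCharpolyAt v P₂ ∧ P.map red = P₁ * P₂))
      let AutGL4 := fun (hcpt : isCompact_glFiniteIntegralLevel 4 ℚ) (ι : PadicAlgCl p ≃+* ℂ)
          (r : FramedGaloisRep ℚ (PadicAlgCl p) 4) =>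
        (∃ π : CuspidalAutomorphicRepData 4 ℚ hcpt, π.1.IsLAlgebraic ∧
          ∀ᶠ v : HeightOneSpectrum (NumberField.RingOfIntegers ℚ) in Filter.cofinite,
            ∃ a : Multiset ℂ, π.1.HasSatakeParamAt v a ∧ r.IsUnramifiedAt v ∧
              r.HasFrobCharpolyAt v (arithFrobPolyOfSatake ι v.residueCard 1 a))
      let OrdLine := fun (v : HeightOneSpectrum (NumberField.RingOfIntegers ℚ))
          (s : FramedGaloisRep ℚ k 2) (g : GL (Fin 2) k) =>
        (∀ τ, ((g * s.toLocal v τ * g⁻¹ : GL (Fin 2) k) : Matrix (Fin 2) (Fin 2) k) 1 0 = 0) ∧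
        (∀ τ ∈ absInertia (v.adicCompletion ℚ),
          ((g * s.toLocal v τ * g⁻¹ : GL (Fin 2) k) : Matrix (Fin 2) (Fin 2) k) 0 0 = 1)
      -- the model (Stub 1)
      (∀ g, (Matrix.GeneralLinearGroup.map (ZMod.castHom (dvd_refl p) k) (ρb g)).val =
          h.val * Matrix.reindex finSumFinEquiv finSumFinEquiv
            (Matrix.fromBlocks (σ g).val 0 0 (σ' g).val) * (h⁻¹).val) →
      ρb.IsSymplecticWithMultiplierFun (fun g => (((εb g)⁻¹ : (ZMod p)ˣ) : ZMod p)) →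
      -- ordinary lines at 3 with distinct unramified characters (Stub 2)
      (∀ v : HeightOneSpectrum (NumberField.RingOfIntegers ℚ),
        ((p : ℕ) : NumberField.RingOfIntegers ℚ) ∈ v.asIdeal →
          ∃ g g' : GL (Fin 2) k, OrdLine v σ g ∧ OrdLine v σ' g' ∧
            ∃ τ, ((g * σ.toLocal v τ * g⁻¹ : GL (Fin 2) k) : Matrix (Fin 2) (Fin 2) k) 0 0 ≠
              ((g' * σ'.toLocal v τ * g'⁻¹ : GL (Fin 2) k) : Matrix (Fin 2) (Fin 2) k) 0 0) →
      -- peu ramifié at 3 (sector)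
      (∀ v : HeightOneSpectrum (NumberField.RingOfIntegers ℚ),
        ((p : ℕ) : NumberField.RingOfIntegers ℚ) ∈ v.asIdeal →
          ModPGaloisRep.IsPeuRamifie (σ.toLocal v) ∧ ModPGaloisRep.IsPeuRamifie (σ'.toLocal v)) →
      -- unramified at 2, Frob₂ off 4C/12C (sector)
      (∀ v : HeightOneSpectrum (NumberField.RingOfIntegers ℚ),
        ((2 : ℕ) : NumberField.RingOfIntegers ℚ) ∈ v.asIdeal →
          σ.IsUnramifiedAt v ∧ σ'.IsUnramifiedAt v ∧
          ∃ P₁ P₂ : Polynomial k, σ.HasFrobCharpolyAt v P₁ ∧ σ'.HasFrobCharpolyAt v P₂ ∧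
            P₁ * P₂ ≠ (X ^ 2 + X + C 2) ^ 2 ∧ P₁ * P₂ ≠ (X ^ 2 - X + C 2) ^ 2) →
      ∀ (hcpt : isCompact_glFiniteIntegralLevel 4 ℚ) (ι : PadicAlgCl p ≃+* ℂ),
        ∃ ρ₀ : FramedGaloisRep ℚ (PadicAlgCl p) 4,
          ρ₀.toGaloisRep.IsIrreducible ∧ Sh ρ₀ ∧ AutGL4 hcpt ι ρ₀ := by
  sorry

/-! ## Stub 4 — the residue off the Burkhardt–Weddle sector (open; not claimed by this line) -/

/-- **Stub 4 (off-sector residue; OPEN — the honest remainder of the crux).**  The crux's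
implication (verbatim hypotheses H1–H5, verbatim conclusion) for data `(p, k, red, σ, σ')` OUTSIDE
the sector `p = 3 ∧ 𝔽₃-rational ∧ peu ramifié at 3 ∧ (unramified at 2, Frob₂ ∉ 4C/12C)`.  Contents,
by regime (Disproof §5): `p ≥ 5` generic pairs (R4: `A₂(ρ̄)` of general type, no Diophantine supply;
the singular-weight `ℓ₀ = 1` existence problem — the only automorphic engine on the table is
`serre-dual-ribet-square`'s coherent Ribet square with its decisive Ihara-type stub C⁺; settled
sub-regimes R1 (twist pairs, `p` inert: `ρ_f^∨ ⊗ Ind`) and D1 (dihedral, `χ̄' ∈ im(1-c)`) have explicit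
`ρ₀`); `p = 3` pairs with no `𝔽₃`-model (`P₁P₂ ∉ 𝔽₃[X]`: no `𝔽₃`-rational motive can serve),
très ramifié pairs (Lemma 416 as printed excludes them; BCGP2025 Remark 418 drops only the conditions
at `2`), pairs ramified at `2` or with `Frob₂ ∈ 4C/12C` (no 2-adic modularity theorem available: the
`2`-part of the switch is essential today).  Why it might be provable eventually: expected, as a
consequence of Langlands functoriality / Serre-type conjectures for `GSp₄` plus the existence of
"accidental" de Rham points; why it might fail: a RIGID PAIR (Disproof §3.4, §6: an irregular-weight
non-lifting theorem, expected dimension `-1`; no instance and no obstruction known).  This stub is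
where another line or a planner restatement (`Irr'`, Disproof `closes_irr'`; or the `p = 3` sector as
the item) must take over; it is NOT a restatement of the crux (strictly weaker: the sector is
excluded) but it carries all of the crux's generic difficulty, openly.  Size: open problem.
[cite: BoxerCalegariGeePilloni2025, Remark 9.4.4 (418); Sorensen2006; Sorensen2009; LemmaOchiai2023;
HsiehPalvannan2025; arXiv:2602.20737 (Deo–Palvannan); FakhruddinKharePatrikis2022] -/
theorem stub_offSector :
    ∀ (p : ℕ) [Fact p.Prime], p ≠ 2 → ∀ (k : Type) [Field k] [CharP k p] [IsAlgClosed k]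
      [TopologicalSpace k] [DiscreteTopology k] (red : Valued.integer (PadicAlgCl p) →+* k)
      (σ σ' : FramedGaloisRep ℚ k 2),
      let εb : Field.absoluteGaloisGroup ℚ →* (ZMod p)ˣ :=
        (modularCyclotomicCharacter (AlgebraicClosure ℚ)
          (HasEnoughRootsOfUnity.natCard_rootsOfUnity (AlgebraicClosure ℚ) p)).comp
          (MulSemiringAction.toRingAut (Field.absoluteGaloisGroup ℚ) (AlgebraicClosure ℚ))
      let Sh := fun r : FramedGaloisRep ℚ (PadicAlgCl p) 4 =>
        (r.IsSymplecticWithMultiplierFun (fun g => algebraMap ℚ_[p] (PadicAlgCl p)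
          ((((GaloisRep.cyclotomicCharacter ℚ p g)⁻¹ : ℤ_[p]ˣ) : ℤ_[p]) : ℚ_[p])) ∧
        (∀ v : HeightOneSpectrum (NumberField.RingOfIntegers ℚ),
          ((p : ℕ) : NumberField.RingOfIntegers ℚ) ∈ v.asIdeal →
            r.IsGreenbergOrdinaryOfShapeAt v ![0, 0, 1, 1] ∧ r.IsResiduallyDistinguishedAt v ![0, 0, 1, 1]) ∧
        (∀ᶠ v : HeightOneSpectrum (NumberField.RingOfIntegers ℚ) in Filter.cofinite,
          r.IsUnramifiedAt v ∧ σ.IsUnramifiedAt v ∧ σ'.IsUnramifiedAt v ∧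
          ∃ (P : Polynomial (Valued.integer (PadicAlgCl p))) (P₁ P₂ : Polynomial k),
            r.HasFrobCharpolyAt v (P.map (Valued.integer (PadicAlgCl p)).subtype) ∧
            σ.HasFrobCharpolyAt v P₁ ∧ σ'.HasFrobCharpolyAt v P₂ ∧ P.map red = P₁ * P₂))
      let AutGL2 := fun s : FramedGaloisRep ℚ k 2 =>
        (∀ (hcpt₂ : isCompact_glFiniteIntegralLevel 2 ℚ) (ι : PadicAlgCl p ≃+* ℂ),
          ∃ π₂ : CuspidalAutomorphicRepData 2 ℚ hcpt₂, π₂.1.IsLAlgebraic ∧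
            ∀ᶠ v : HeightOneSpectrum (NumberField.RingOfIntegers ℚ) in Filter.cofinite,
              ∃ (a : Multiset ℂ) (P : Polynomial (Valued.integer (PadicAlgCl p))) (Pb : Polynomial k),
                π₂.1.HasSatakeParamAt v a ∧
                P.map (Valued.integer (PadicAlgCl p)).subtype =
                  arithFrobPolyOfSatake ι v.residueCard 1 a ∧
                s.IsUnramifiedAt v ∧ s.HasFrobCharpolyAt v Pb ∧ P.map red = Pb)
      let AutGL4 := fun (hcpt : isCompact_glFiniteIntegralLevel 4 ℚ) (ι : PadicAlgCl p ≃+* ℂ)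
          (r : FramedGaloisRep ℚ (PadicAlgCl p) 4) =>
        (∃ π : CuspidalAutomorphicRepData 4 ℚ hcpt, π.1.IsLAlgebraic ∧
          ∀ᶠ v : HeightOneSpectrum (NumberField.RingOfIntegers ℚ) in Filter.cofinite,
            ∃ a : Multiset ℂ, π.1.HasSatakeParamAt v a ∧ r.IsUnramifiedAt v ∧
              r.HasFrobCharpolyAt v (arithFrobPolyOfSatake ι v.residueCard 1 a))
      -- NOT in the Burkhardt–Weddle sector
      ¬ (p = 3 ∧
          (∀ g : Field.absoluteGaloisGroup ℚ, ∃ Q : Polynomial (ZMod p),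
            Q.map (ZMod.castHom (dvd_refl p) k) = (σ g).val.charpoly * (σ' g).val.charpoly) ∧
          (∀ v : HeightOneSpectrum (NumberField.RingOfIntegers ℚ),
            ((p : ℕ) : NumberField.RingOfIntegers ℚ) ∈ v.asIdeal →
              ModPGaloisRep.IsPeuRamifie (σ.toLocal v) ∧ ModPGaloisRep.IsPeuRamifie (σ'.toLocal v)) ∧
          (∀ v : HeightOneSpectrum (NumberField.RingOfIntegers ℚ),
            ((2 : ℕ) : NumberField.RingOfIntegers ℚ) ∈ v.asIdeal →
              σ.IsUnramifiedAt v ∧ σ'.IsUnramifiedAt v ∧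
              ∃ P₁ P₂ : Polynomial k, σ.HasFrobCharpolyAt v P₁ ∧ σ'.HasFrobCharpolyAt v P₂ ∧
                P₁ * P₂ ≠ (X ^ 2 + X + C 2) ^ 2 ∧ P₁ * P₂ ≠ (X ^ 2 - X + C 2) ^ 2)) →
      AutGL2 σ → AutGL2 σ' → σ.toGaloisRep.IsIrreducible → σ'.toGaloisRep.IsIrreducible →
      (∀ g, FramedRep.det σ g = (Units.map (ZMod.castHom (dvd_refl p) k).toMonoidHom (εb g))⁻¹ ∧
        FramedRep.det σ' g = FramedRep.det σ g) →
      (¬ ∃ g : GL (Fin 2) k, ∀ x, g * σ x * g⁻¹ = σ' x) →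
      (∃ ρ : FramedGaloisRep ℚ (PadicAlgCl p) 4, Sh ρ) →
      ∀ (hcpt : isCompact_glFiniteIntegralLevel 4 ℚ) (ι : PadicAlgCl p ≃+* ℂ),
        ∃ ρ₀ : FramedGaloisRep ℚ (PadicAlgCl p) 4,
          ρ₀.toGaloisRep.IsIrreducible ∧ Sh ρ₀ ∧ AutGL4 hcpt ι ρ₀ := by
  sorry

/-! ## Glue (sorry-free): the crux from the four stubs -/

/-- **`StableYoshidaCongruence` from the line `burkhardt-weddle-two-three-anchor`.**  Case split on
the Burkhardt–Weddle sector.  On the sector: the `Sh`-witness of H5 gives distinct unramified lines of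
`σ̄, σ̄'` at `3` (Stub 2); `𝔽₃`-rationality gives the symplectic `𝔽₃`-model `ρ̄₃` (Stub 1); the 2–3
switch (Stub 3) returns an irreducible automorphic `Sh`-lift `ρ₀`.  Off the sector: Stub 4. -/
theorem StableYoshidaCongruence_of :
    Summit.Langlands.Langlands.Theses.PhantomRMYoshida.StableYoshidaCongruence := by
  intro p _ hp k _ _ _ _ _ red σ σ' εb Sh AutGL2 h₁ h₂ hirr hirr' hdet hnc hw hcpt ι
  refine (Classical.em _).elim (fun hsec => ?_)
    (fun hsec => stub_offSector p hp k red σ σ' hsec h₁ h₂ hirr hirr' hdet hnc hw hcpt ι)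
  obtain ⟨hp3, hrat, hpeu, htwo⟩ := hsec
  obtain ⟨ρ, hρ⟩ := hw
  -- Stub 2: distinct unramified lines at `3` from the `Sh`-witness
  have hord := stub_ordinaryLinesAtP p hp k red σ σ' ρ hirr hirr' hdet hρ.2.1 hρ.2.2
  -- Stub 1: the symplectic `𝔽₃`-model
  obtain ⟨ρb, h, hmodel, hsymp⟩ := stub_symplecticModelFp p hp k σ σ' hirr hirr' hdet hnc hrat
  -- Stub 3: the 2–3 switch
  exact stub_burkhardtWeddleSwitch p hp hp3 k red σ σ' ρb h hmodel hsymp hord hpeu htwo hcpt ι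

end Summit.Langlands.Langlands.Cruxes.StableYoshidaCongruence.BurkhardtWeddleTwoThreeAnchor
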